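import Mathlib
import Summits.ValiantsHypothesis.ValiantsHypothesis.Theorems.FifoMatchingNNLinearDegreeCofactorHardExcision
import HarnessLib

/-!
# Route FifoMatching — crux `NNLinearDegreeCofactorHard` (stmt-ValiantsHypothesis-23918), line `internal_cofactor`:
# outer witnesses for EXCISION (stub S2b) from three blocks

`…Excision.lean` restricts the `R`-avoiding nest-free matching polynomial `P_R(2n)` to a carved
interval `I = [a, a + 2m)` given an OUTER WITNESS: a nest-free perfect matching `M₀` of `[2n]`
avoiding `R` and mapping the outside of `I` to itself.  This file builds such a witness from
`R`-avoiding nest-free perfect matchings of the three blocks `[0, a)`, `I`, `[a + 2m, 2n)` (each read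
in its own `Fin (2k)`, the trace of `R` transported), by gluing them in turn onto the
consecutive-pairs matching (`glue_mem_nestFreeMatchings` of `…Excision.lean`):

* `glue_apply_not_mem`, `glue_apply_mem_I` — on `I` a glued matching avoids `R` (if the glued block
  matching avoids the trace of `R`) and stays in `I`;
* `exists_outer_witness` — the three-block constructor.

So the witness hypothesis of `aeval_excise_avoiding` / `complexity_excised_le_mul_internal` /
`denseInternalHard_of_excisedAvoidingSpread` is discharged by three instances of the nonemptiness
statement "`|R' | ≤ k ⇒` some nest-free perfect matching of `Fin (2k)` avoids `R'`".

Honest framing: plumbing for one registered stub of one line of an OPEN crux; nothing here bears on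
the crux, `NNDivisionHard`, `NNNotVP` or `VP ≠ VNP` (NOT proved); monotone ≠ general
(`…Barriers.ValiantsHypothesis.MonotoneGap`).  No definitions, no named facts. [folklore]
-/

noncomputable section

-- Sub = Summit single-conjunct layout: the duplicated namespace component is mandated by the tree.
set_option linter.dupNamespace false

namespace Summit.ValiantsHypothesis.ValiantsHypothesis.Theorems.FifoMatching.NNLinearDegreeCofactorHard.InternalCofactor

open MvPolynomial Finset Literature.Computability.AlgebraicComplexity
open Summit.ValiantsHypothesis.ValiantsHypothesis.Theorems.FifoMatching.NNLowDegreeCofactorHard.FreedVertices.Carve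
open scoped NNReal

variable {n : ℕ} (C : Carving n)

/-! ### Pointwise `R`-avoidance of a glued matching on `I` -/
/-- On `I`, the glue of an `R'`-avoiding `N` avoids `R` (`R' = R ∩ I` read in `[2m]`), whatever the
outer matching. [folklore] -/
theorem glue_apply_not_mem (R : Finset (Fin (2 * n))) (M₀ : Fin (2 * n) → Fin (2 * n))
    {N : Fin (2 * C.m) → Fin (2 * C.m)}
    (hN : ∀ j ∈ (univ.filter fun j : Fin (2 * C.m) => C.up j ∈ R),
      N j ∉ (univ.filter fun j : Fin (2 * C.m) => C.up j ∈ R))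
    {i : Fin (2 * n)} (hi : i ∈ C.I) (hiR : i ∈ R) :
    (fun i => if i ∈ C.I then C.up (N (C.dn i)) else M₀ i) i ∉ R := by
  have h := hN (C.dn i) (by rw [mem_filter, C.up_dn hi]; exact ⟨mem_univ _, hiR⟩)
  rw [mem_filter] at h
  show (if i ∈ C.I then C.up (N (C.dn i)) else M₀ i) ∉ R
  rw [if_pos hi]
  exact fun h' => h ⟨mem_univ _, h'⟩

/-- On `I`, a glued map takes values in `I`. [folklore] -/
theorem glue_apply_mem_I (M₀ : Fin (2 * n) → Fin (2 * n)) (N : Fin (2 * C.m) → Fin (2 * C.m))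
    {i : Fin (2 * n)} (hi : i ∈ C.I) :
    (fun i => if i ∈ C.I then C.up (N (C.dn i)) else M₀ i) i ∈ C.I := by
  show (if i ∈ C.I then C.up (N (C.dn i)) else M₀ i) ∈ C.I
  rw [if_pos hi]
  exact C.up_mem_I _

/-! ### The three-block outer witness -/
/-- **Outer witnesses from three blocks.**  Given `R'`-avoiding nest-free perfect matchings of the
three blocks `[0, a)`, `I = [a, a + 2m)`, `[a + 2m, 2n)` of a carving (each block read in its own
`Fin (2k)`, `R'` the trace of `R`), gluing them onto the consecutive-pairs matching yields an OUTER
WITNESS: a nest-free perfect matching of `[2n]` avoiding `R` and mapping the outside of `I` to itself.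
So three instances of "`|R ∩ B| ≤ |B|/2 ⇒` an `R`-avoiding nest-free perfect matching of the block `B`
exists" discharge the witness hypothesis of `aeval_excise_avoiding`. [folklore] -/
theorem exists_outer_witness (R : Finset (Fin (2 * n)))
    (hL : ∃ N ∈ nestFreeMatchings (2 * (C.a / 2)),
      ∀ j ∈ (univ.filter fun j : Fin (2 * (C.a / 2)) => (Fin.castLE (by have := C.le; omega) j : Fin (2 * n)) ∈ R),
        N j ∉ (univ.filter fun j : Fin (2 * (C.a / 2)) => (Fin.castLE (by have := C.le; omega) j : Fin (2 * n)) ∈ R))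
    (hMid : ∃ N ∈ nestFreeMatchings (2 * C.m),
      ∀ j ∈ (univ.filter fun j : Fin (2 * C.m) => C.up j ∈ R),
        N j ∉ (univ.filter fun j : Fin (2 * C.m) => C.up j ∈ R))
    (hRt : ∃ N ∈ nestFreeMatchings (2 * (n - C.a / 2 - C.m)),
      ∀ j ∈ (univ.filter fun j : Fin (2 * (n - C.a / 2 - C.m)) =>
          (Fin.natAdd (C.a + 2 * C.m) j |>.cast (by have := C.le; have := C.even; omega) : Fin (2 * n)) ∈ R),
        N j ∉ (univ.filter fun j : Fin (2 * (n - C.a / 2 - C.m)) =>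
          (Fin.natAdd (C.a + 2 * C.m) j |>.cast (by have := C.le; have := C.even; omega) : Fin (2 * n)) ∈ R)) :
    ∃ M₀ ∈ nestFreeMatchings (2 * n), (∀ i ∈ R, M₀ i ∉ R) ∧ (∀ i, i ∉ C.I → M₀ i ∉ C.I) := by
  obtain ⟨NL, hNL, hNLR⟩ := hL
  obtain ⟨NM, hNM, hNMR⟩ := hMid
  obtain ⟨NR, hNR, hNRR⟩ := hRt
  have hle := C.le
  have heven := C.even
  have hpos := C.pos
  -- Step 1: the left block
  obtain ⟨M₁, hM₁, hM₁out, hM₁in, hM₁R⟩ : ∃ M₁ ∈ nestFreeMatchings (2 * n),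
      (∀ i : Fin (2 * n), C.a ≤ i.val → M₁ i = partner i) ∧
      (∀ i : Fin (2 * n), i.val < C.a → (M₁ i).val < C.a) ∧
      (∀ i ∈ R, i.val < C.a → M₁ i ∉ R) := by
    rcases Nat.eq_zero_or_pos (C.a / 2) with h0 | hposL
    · refine ⟨fun i => partner i, partner_mem_nestFreeMatchings n, fun i _ => rfl,
        fun i hi => absurd hi (by omega), fun i _ hi => absurd hi (by omega)⟩
    · let CL : Carving n := ⟨0, C.a / 2, by omega, hposL, rfl⟩
      have hIL : ∀ i : Fin (2 * n), i ∈ CL.I ↔ i.val < C.a := fun i => by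
        rw [CL.mem_I]; constructor
        · intro h; have := h.2; simp only [CL] at this; omega
        · intro h; refine ⟨Nat.zero_le _, ?_⟩; show i.val < 0 + 2 * (C.a / 2); omega
      have hupL : ∀ j : Fin (2 * (C.a / 2)),
          CL.up j = (Fin.castLE (by have := C.le; omega) j : Fin (2 * n)) := fun j =>
        Fin.ext (by simp [CL, Carving.coe_up])
      have hNLR' : ∀ j ∈ (univ.filter fun j : Fin (2 * CL.m) => CL.up j ∈ R),
          NL j ∉ (univ.filter fun j : Fin (2 * CL.m) => CL.up j ∈ R) := by
        intro j hj
        simp only [mem_filter, mem_univ, true_and, hupL] at hj ⊢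
        have := hNLR j (by simpa using hj)
        simpa using this
      refine ⟨fun i => if i ∈ CL.I then CL.up (NL (CL.dn i)) else partner i,
        glue_mem_nestFreeMatchings CL (partner_mem_nestFreeMatchings n)
          (fun i hi => CL.partner_not_mem_I hi) hNL, fun i hi => ?_, fun i hi => ?_, fun i hiR hi => ?_⟩
      · have : i ∉ CL.I := fun h => by rw [hIL] at h; omega
        exact if_neg this
      · have h1 := glue_apply_mem_I CL (fun i => partner i) NL ((hIL i).2 hi)
        exact (hIL _).1 h1
      · exact glue_apply_not_mem CL R (fun i => partner i) hNLR' ((hIL i).2 hi) hiR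
  -- Step 2: the middle block
  have hM₁outI : ∀ i, i ∉ C.I → M₁ i ∉ C.I := by
    intro i hi
    by_cases hlt : i.val < C.a
    · have := hM₁in i hlt
      rw [C.mem_I]; omega
    · rw [hM₁out i (by omega)]
      exact C.partner_not_mem_I hi
  set M₂ : Fin (2 * n) → Fin (2 * n) := fun i => if i ∈ C.I then C.up (NM (C.dn i)) else M₁ i with hM₂def
  have hM₂ : M₂ ∈ nestFreeMatchings (2 * n) := glue_mem_nestFreeMatchings C hM₁ hM₁outI hNM
  have hM₂out : ∀ i, i ∉ C.I → M₂ i = M₁ i := fun i hi => if_neg hi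
  have hM₂inI : ∀ i, i ∈ C.I → M₂ i ∈ C.I := fun i hi => glue_apply_mem_I C M₁ NM hi
  have hM₂R : ∀ i ∈ R, i ∈ C.I → M₂ i ∉ R := fun i hiR hi => glue_apply_not_mem C R M₁ hNMR hi hiR
  -- Step 3: the right block
  obtain ⟨M₃, hM₃, hM₃out, hM₃in, hM₃R⟩ : ∃ M₃ ∈ nestFreeMatchings (2 * n),
      (∀ i : Fin (2 * n), i.val < C.a + 2 * C.m → M₃ i = M₂ i) ∧
      (∀ i : Fin (2 * n), C.a + 2 * C.m ≤ i.val → C.a + 2 * C.m ≤ (M₃ i).val) ∧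
      (∀ i ∈ R, C.a + 2 * C.m ≤ i.val → M₃ i ∉ R) := by
    rcases Nat.eq_zero_or_pos (n - C.a / 2 - C.m) with h0 | hposR
    · refine ⟨M₂, hM₂, fun i _ => rfl, fun i hi => absurd i.2 (by omega),
        fun i _ hi => absurd i.2 (by omega)⟩
    · let CR : Carving n := ⟨C.a + 2 * C.m, n - C.a / 2 - C.m, by omega, hposR, by omega⟩
      have hIR : ∀ i : Fin (2 * n), i ∈ CR.I ↔ C.a + 2 * C.m ≤ i.val := fun i => by
        rw [CR.mem_I]; constructor
        · intro h; exact h.1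
        · intro h; refine ⟨h, ?_⟩; show i.val < C.a + 2 * C.m + 2 * (n - C.a / 2 - C.m); omega
      have hupR : ∀ j : Fin (2 * (n - C.a / 2 - C.m)),
          CR.up j = ((Fin.natAdd (C.a + 2 * C.m) j).cast
            (by have := C.le; have := C.even; omega) : Fin (2 * n)) := fun j =>
        Fin.ext (by simp [CR, Carving.coe_up])
      have hNRR' : ∀ j ∈ (univ.filter fun j : Fin (2 * CR.m) => CR.up j ∈ R),
          NR j ∉ (univ.filter fun j : Fin (2 * CR.m) => CR.up j ∈ R) := by
        intro j hj
        simp only [mem_filter, mem_univ, true_and, hupR] at hj ⊢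
        have := hNRR j (by simpa using hj)
        simpa using this
      have hM₂outR : ∀ i, i ∉ CR.I → M₂ i ∉ CR.I := by
        intro i hi
        rw [hIR] at hi ⊢
        by_cases hiC : i ∈ C.I
        · have := hM₂inI i hiC
          rw [C.mem_I] at this; omega
        · rw [hM₂out i hiC]
          have hlt : i.val < C.a := by rw [C.mem_I] at hiC; omega
          have := hM₁in i hlt
          omega
      refine ⟨fun i => if i ∈ CR.I then CR.up (NR (CR.dn i)) else M₂ i,
        glue_mem_nestFreeMatchings CR hM₂ hM₂outR hNR, fun i hi => ?_, fun i hi => ?_,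
        fun i hiR hi => ?_⟩
      · have : i ∉ CR.I := fun h => by rw [hIR] at h; omega
        exact if_neg this
      · have h1 := glue_apply_mem_I CR M₂ NR ((hIR i).2 hi)
        exact (hIR _).1 h1
      · exact glue_apply_not_mem CR R M₂ hNRR' ((hIR i).2 hi) hiR
  -- Conclusion
  refine ⟨M₃, hM₃, fun i hiR => ?_, fun i hi => ?_⟩
  · by_cases h3 : C.a + 2 * C.m ≤ i.val
    · exact hM₃R i hiR h3
    · rw [hM₃out i (by omega)]
      by_cases h2 : i ∈ C.I
      · exact hM₂R i hiR h2
      · rw [hM₂out i h2]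
        have h1 : i.val < C.a := by rw [C.mem_I] at h2; omega
        exact hM₁R i hiR h1
  · by_cases h3 : C.a + 2 * C.m ≤ i.val
    · have := hM₃in i h3
      rw [C.mem_I]; omega
    · rw [hM₃out i (by omega), hM₂out i hi]
      exact hM₁outI i hi

end Summit.ValiantsHypothesis.ValiantsHypothesis.Theorems.FifoMatching.NNLinearDegreeCofactorHard.InternalCofactor

end
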